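import Literature.AlgebraicGeometry.Frobenioids.ArithmeticFrobenioidThm64ivSolitaryCor411
import Literature.AlgebraicGeometry.Frobenioids.ArithmeticFrobenioidThm64ivSylow
import Literature.AlgebraicGeometry.Frobenioids.ArithmeticFrobenioidThm64ivGaloisTarget
import HarnessLib

/-!
# Frobenioids I, Theorem 6.4 (iv), second clause over the TYPED cone node Cor. 4.11 (iv): the target-Galois and
# Sylow classes (GAP-LEDGER G-L1t3-1 #2; sequel of `ArithmeticFrobenioidThm64ivSolitaryCor411.lean`)

Mochizuki, *The geometry of Frobenioids I: the general theory*, Kyushu J. Math. **62** (2008) 293–400, §6,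
Thm. 6.4 (iv) p. 115 l. 23–29 [cite: MochizukiFrdI2008, Thm. 6.4 (iv) p.115].

PROOF-ONLY file (cell abc-iut, layer L1; seat abc-iut-w4-d090 gen 5; 0 definitions): `F₁ ≅ F₂` from the typed node
[FrdI] Cor. 4.11 (iv) for `Ψ` (binder `h411iv`, unpacked inline as in the prequel) when the target base `F₂` is
Galois over `ℚ` (`…GaloisTarget`) or `Gal(L₁/F₁)` is a Sylow subgroup of `Gal(L₁/ℚ)` (`…Sylow`). Nothing here bears
on, or takes a side on, [IUTchIII] Cor. 3.12.
-/

noncomputable section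

namespace Literature.AlgebraicGeometry.Frobenioids

open CategoryTheory Opposite NumberField
open Literature.NumberTheory.NumberFields

section Arith

variable {F₁ : Type} [Field F₁] [NumberField F₁] {K₁ : Type} [Field K₁] [Algebra F₁ K₁] [IsGalois F₁ K₁]
variable {F₂ : Type} [Field F₂] [NumberField F₂] {K₂ : Type} [Field K₂] [Algebra F₂ K₂] [IsGalois F₂ K₂]

/-- The Cor. 4.11 (iv) datum of `Ψ` unpacked from the typed node at THE parameters (as in the prequel).
[cite: MochizukiFrdI2008, Cor. 4.11 (iv) p.92] -/
private theorem datum_of_cor411iv' (Ψ : arithFrobenioid F₁ K₁ ≌ arithFrobenioid F₂ K₂)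
    (h411iv : PreFrobenioidData.Cor411iv (arithFrobenioidOps F₁ K₁) (arithFrobenioidOps F₂ K₂) Ψ
      (PreFrobenioid.rsParams (arithFrobenioid_isFrobenioid F₁ K₁) fun a 𝔭 => PrimarySupp a 𝔭)
      (PreFrobenioid.rsParams (arithFrobenioid_isFrobenioid F₂ K₂) fun a 𝔭 => PrimarySupp a 𝔭)) :
    ∃ (ΨBase : FinSubextCat F₁ K₁ ⥤ FinSubextCat F₂ K₂)
      (E : PreFrobenioidData.DivisorMonoidIsoOverBase (arithFrobenioidOps F₁ K₁) (arithFrobenioidOps F₂ K₂) ΨBase)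
      (η : Ψ.functor ⋙ (arithFrobenioidOps F₂ K₂).base ≅ (arithFrobenioidOps F₁ K₁).base ⋙ ΨBase),
      ΨBase.IsEquivalence ∧
      ∀ ⦃A B : arithFrobenioid F₁ K₁⦄ (φ : A ⟶ B),
        (arithFrobenioidOps F₂ K₂).div (Ψ.functor.map φ) =
          (arithFrobenioidOps F₂ K₂).pull (η.hom.app A)
            (E.iso ((arithFrobenioidOps F₁ K₁).base.obj A) ((arithFrobenioidOps F₁ K₁).div φ)) := by
  obtain ⟨ΨBase, E, η, hEq, -, hdiv, -⟩ :=
    h411iv (cor411Setting_arith F₁ K₁ F₂ K₂ Ψ) (Thm64i_frobenioid_rsParams F₁ K₁).2.1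
      (Thm64i_frobenioid_rsParams F₂ K₂).2.1
  exact ⟨ΨBase, E, η, hEq, hdiv⟩

/-- **`F₁ ≅ F₂` from the typed Cor. 4.11 (iv) when the TARGET base `F₂` is Galois over `ℚ`** (given one
`X = Spec L₁` with `L₁` Galois over `ℚ`). [cite: MochizukiFrdI2008, Thm. 6.4 (iv) p.115] -/
theorem nonempty_baseRingEquiv_of_cor411iv_of_isGalois_target [IsGalois ℚ F₂]
    (Ψ : arithFrobenioid F₁ K₁ ≌ arithFrobenioid F₂ K₂)
    (h411iv : PreFrobenioidData.Cor411iv (arithFrobenioidOps F₁ K₁) (arithFrobenioidOps F₂ K₂) Ψ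
      (PreFrobenioid.rsParams (arithFrobenioid_isFrobenioid F₁ K₁) fun a 𝔭 => PrimarySupp a 𝔭)
      (PreFrobenioid.rsParams (arithFrobenioid_isFrobenioid F₂ K₂) fun a 𝔭 => PrimarySupp a 𝔭))
    (X : FinSubextCat F₁ K₁) (hX : IsGalois ℚ X.L) : Nonempty (F₁ ≃+* F₂) := by
  obtain ⟨ΨBase, E, η, hEq, hdiv⟩ := datum_of_cor411iv' Ψ h411iv
  exact nonempty_baseRingEquiv_arith_of_isGalois_target Ψ E η hdiv ⟨⊥⟩ (IntermediateField.botEquiv F₁ K₁) X hX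

/-- **`F₁ ≅ F₂` from the typed Cor. 4.11 (iv) in the SYLOW case**: some `X = Spec L₁` with `L₁` Galois over `ℚ`,
`[L₁ : ℚ] = p^k · [F₁ : ℚ]` and `p ∤ [F₁ : ℚ]`. [cite: MochizukiFrdI2008, Thm. 6.4 (iv) p.115] -/
theorem nonempty_baseRingEquiv_of_cor411iv_of_sylow (Ψ : arithFrobenioid F₁ K₁ ≌ arithFrobenioid F₂ K₂)
    (h411iv : PreFrobenioidData.Cor411iv (arithFrobenioidOps F₁ K₁) (arithFrobenioidOps F₂ K₂) Ψ
      (PreFrobenioid.rsParams (arithFrobenioid_isFrobenioid F₁ K₁) fun a 𝔭 => PrimarySupp a 𝔭)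
      (PreFrobenioid.rsParams (arithFrobenioid_isFrobenioid F₂ K₂) fun a 𝔭 => PrimarySupp a 𝔭))
    (X : FinSubextCat F₁ K₁) (hX : IsGalois ℚ X.L) {p k : ℕ} (hp : p.Prime)
    (hdeg : Module.finrank ℚ X.L = p ^ k * Module.finrank ℚ F₁) (hcop : ¬ p ∣ Module.finrank ℚ F₁) :
    Nonempty (F₁ ≃+* F₂) := by
  obtain ⟨ΨBase, E, η, hEq, hdiv⟩ := datum_of_cor411iv' Ψ h411iv
  exact nonempty_baseRingEquiv_arith_of_sylow Ψ E η hdiv ⟨⊥⟩ (IntermediateField.botEquiv F₁ K₁) X hX hp hdeg hcop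

end Arith

end Literature.AlgebraicGeometry.Frobenioids

end
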